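import Literature.Analysis.FluidPDE.RemainderEnergyInequalityGlobal
import Literature.Analysis.FluidPDE.WeakL3SplittingCaloricField
import Literature.Analysis.FluidPDE.SereginZajaczkowski2007L42Vorticity
import HarnessLib

/-!
# The initial layer of bounded mild solutions with weak-`L³` data (BSS 2016, Lemma 3.4)

Analysis/FluidPDE support file (theorems only) on the discharge path of
`Literature.Analysis.FluidPDE.AlbrittonBarker2019_liouville_weakL3_backward`: the layer hypothesis
`hLayer` of `AlbrittonBarker2019_liouville_weakL3_backward_of_localEnergy_of_layer`. For a
bounded, jointly continuous, weakly divergence-free solution `u` of the Oseen integral equation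
on `[0, S] × ℝ³`, `S ≤ 1`, with `‖u(0)‖_{L^{3,∞}}³ ≤ M`, Barker–Seregin–Šverák's global energy
method (arXiv:1603.03211, Lemma 3.4) gives
`‖u(τ) − e^{τΔ}u(0)‖_{L²(ℝ³)} ≤ Λ(M) τ^{1/4}` for `τ ∈ (0, S)` (`weakL3_initial_layer`):
split `u(0) = ḡ + g̃` at height `N = τ^{-1/2}` (`weakL3_splitting`), let `E` be the
divergence-free caloric field of `ḡ` (`caloricField_bounds`), `w = u − E`; the global energy
inequality of `w` (`remainder_energy_inequality`, with the Riesz pressure of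
`exists_rieszPressure_suitable_slab_of_oseenForward`) is linearised
(`2M√y ≤ λy + M²/λ`, `λ(s) = τ^{-1/4}s^{-3/4}`) and closed by Grönwall's lemma
(`lintegral_gronwall_le_of_Icc`) on `[t₁, τ]`, `t₁ → 0`.

## References

* T. Barker, G. Seregin, V. Šverák, *On stability of weak Navier–Stokes solutions with large
  `L^{3,∞}` initial data*, Comm. PDE 43 (2018) = arXiv:1603.03211, Lemma 3.4. [`BarkerSeregin2016`]
* J. C. Robinson, J. L. Rodrigo, W. Sadowski, *The three-dimensional Navier–Stokes equations*
  (2016), Lemma A.25 (Grönwall). [`RobinsonRodrigoSadowski2016`]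
-/

noncomputable section

open MeasureTheory Set Function Filter Metric TopologicalSpace InnerProductSpace
open _root_.Topology
open scoped NNReal ENNReal Laplacian RealInnerProductSpace ContDiff

namespace Literature.Analysis.FluidPDE

open UnboundedOperators FunctionSpaces

/-! ### Real-variable tools -/

/-- `(‖f‖_{L²}).toReal² = ∫ |f|²` for `f ∈ L²`. [folklore] -/
theorem toReal_eLpNorm_two_sq_eq_integral {α F : Type*} [MeasurableSpace α] {μ : Measure α}
    [NormedAddCommGroup F] {f : α → F} (hf : MemLp f 2 μ) :
    (eLpNorm f 2 μ).toReal ^ 2 = ∫ x, ‖f x‖ ^ 2 ∂μ := by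
  have h := hf.eLpNorm_eq_integral_rpow_norm (by norm_num) (by norm_num)
  rw [h, ENNReal.toReal_ofReal (by positivity), ENNReal.toReal_ofNat]
  have hI : 0 ≤ ∫ x, ‖f x‖ ^ (2 : ℝ) ∂μ := integral_nonneg fun x => by positivity
  rw [← Real.rpow_natCast, ← Real.rpow_mul hI]
  norm_num

/-- **Grönwall's lemma, real form on `[t₁, τ]`**: if `0 ≤ y ≤ B_y` is measurable on `(t₁, τ]`,
`α ≥ 0` is continuous on `[t₁, τ]`, `β ≥ 0` is integrable on `(t₁, τ]`, and
`y(t) ≤ y(t₁) + ∫_{(t₁,t]} (α y + β)` for all `t ∈ [t₁, τ]`, then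
`y(τ) ≤ (y(t₁) + ∫_{(t₁,τ]} β) exp(∫_{(t₁,τ]} α)` (`lintegral_gronwall_le_of_Icc`).
[cite: RobinsonRodrigoSadowski2016, Lemma A.25] -/
theorem gronwall_real_Icc {t₁ τ By : ℝ} (h1τ : t₁ ≤ τ) {y α β : ℝ → ℝ}
    (hy0 : ∀ t, 0 ≤ y t) (hyB : ∀ t ∈ Icc t₁ τ, y t ≤ By)
    (hym : AEStronglyMeasurable y (volume.restrict (Ioc t₁ τ)))
    (hα : ContinuousOn α (Icc t₁ τ)) (hα0 : ∀ t ∈ Icc t₁ τ, 0 ≤ α t)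
    (hβ : IntegrableOn β (Ioc t₁ τ) volume) (hβ0 : ∀ t ∈ Ioc t₁ τ, 0 ≤ β t)
    (hineq : ∀ t ∈ Icc t₁ τ, y t ≤ y t₁ + ∫ s in Ioc t₁ t, (α s * y s + β s)) :
    y τ ≤ (y t₁ + ∫ s in Ioc t₁ τ, β s) * Real.exp (∫ s in Ioc t₁ τ, α s) := by
  -- bounds of `α`
  obtain ⟨A, hA⟩ := isCompact_Icc.exists_bound_of_continuousOn hα
  have hA' : ∀ t ∈ Icc t₁ τ, α t ≤ A := fun t ht => (le_abs_self _).trans ((Real.norm_eq_abs _).symm.le.trans (hA t ht))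
  have hBy0 : 0 ≤ By := (hy0 t₁).trans (hyB t₁ ⟨le_rfl, h1τ⟩)
  -- integrability of `α y` on `(t₁, τ]`
  have hαm : AEStronglyMeasurable α (volume.restrict (Ioc t₁ τ)) :=
    (hα.mono Ioc_subset_Icc_self).aestronglyMeasurable measurableSet_Ioc
  haveI : IsFiniteMeasure ((volume : Measure ℝ).restrict (Ioc t₁ τ)) :=
    isFiniteMeasure_restrict.2 measure_Ioc_lt_top.ne
  have hαy : IntegrableOn (fun s => α s * y s) (Ioc t₁ τ) volume := by
    refine ⟨hαm.mul hym, HasFiniteIntegral.of_bounded (C := A * By) ?_⟩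
    filter_upwards [ae_restrict_mem measurableSet_Ioc] with s hs
    rw [norm_mul, Real.norm_of_nonneg (hα0 s (Ioc_subset_Icc_self hs)), Real.norm_of_nonneg (hy0 s)]
    exact mul_le_mul (hA' s (Ioc_subset_Icc_self hs)) (hyB s (Ioc_subset_Icc_self hs)) (hy0 s)
      ((hα0 s (Ioc_subset_Icc_self hs)).trans (hA' s (Ioc_subset_Icc_self hs)))
  have hαI : IntegrableOn α (Ioc t₁ τ) volume := by
    refine ⟨hαm, HasFiniteIntegral.of_bounded (C := A) ?_⟩
    filter_upwards [ae_restrict_mem measurableSet_Ioc] with s hs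
    exact hA s (Ioc_subset_Icc_self hs)
  -- the `ℝ≥0∞` data
  set B : ℝ := y t₁ + ∫ s in Ioc t₁ τ, β s with hB_def
  have hB0 : 0 ≤ B := add_nonneg (hy0 _) (setIntegral_nonneg measurableSet_Ioc hβ0)
  set φ : ℝ → ℝ≥0∞ := fun t => ENNReal.ofReal (y t) with hφ
  set a : ℝ → ℝ≥0∞ := fun t => ENNReal.ofReal (α t) with ha
  have key := SereginZajaczkowski2007.lintegral_gronwall_le_of_Icc (T₀ := t₁) (T₁ := τ) (φ := φ) (a := a)
    (B := ENNReal.ofReal B) (M := ENNReal.ofReal By) ENNReal.ofReal_ne_top ENNReal.ofReal_ne_top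
    (fun t ht => ENNReal.ofReal_le_ofReal (hyB t ht)) ?_ ?_ τ ⟨h1τ, le_rfl⟩
  · -- back to real numbers
    have hfin : ∫⁻ s in Ioo t₁ τ, a s ≠ ⊤ := by
      rw [setLIntegral_congr Ioo_ae_eq_Ioc, ha,
        ← ofReal_integral_eq_lintegral_ofReal hαI ((ae_restrict_mem measurableSet_Ioc).mono
          fun s hs => hα0 s (Ioc_subset_Icc_self hs))]
      exact ENNReal.ofReal_ne_top
    have hexp : (∫⁻ s in Ioo t₁ τ, a s).toReal = ∫ s in Ioc t₁ τ, α s := by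
      rw [setLIntegral_congr Ioo_ae_eq_Ioc, ha,
        ← ofReal_integral_eq_lintegral_ofReal hαI ((ae_restrict_mem measurableSet_Ioc).mono
          fun s hs => hα0 s (Ioc_subset_Icc_self hs)),
        ENNReal.toReal_ofReal (setIntegral_nonneg measurableSet_Ioc fun s hs => hα0 s (Ioc_subset_Icc_self hs))]
    rw [hexp, hφ] at key
    have h2 : ENNReal.ofReal (y τ) ≤ ENNReal.ofReal (B * Real.exp (∫ s in Ioc t₁ τ, α s)) := by
      rw [ENNReal.ofReal_mul hB0]; exact key
    exact (ENNReal.ofReal_le_ofReal_iff (by positivity)).1 h2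
  · -- the kernel has finite integral
    rw [setLIntegral_congr Ioo_ae_eq_Ioc, ha,
      ← ofReal_integral_eq_lintegral_ofReal hαI ((ae_restrict_mem measurableSet_Ioc).mono
        fun s hs => hα0 s (Ioc_subset_Icc_self hs))]
    exact ENNReal.ofReal_ne_top
  · -- the hypothesis of Grönwall's lemma
    intro t ht
    have hsub : Ioc t₁ t ⊆ Ioc t₁ τ := Ioc_subset_Ioc_right ht.2
    have hαy' : IntegrableOn (fun s => α s * y s) (Ioc t₁ t) volume := hαy.mono_set hsub
    have hβ' : IntegrableOn β (Ioc t₁ t) volume := hβ.mono_set hsub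
    have h := hineq t ht
    rw [integral_add hαy' hβ'] at h
    have hβle : ∫ s in Ioc t₁ t, β s ≤ ∫ s in Ioc t₁ τ, β s :=
      setIntegral_mono_set hβ ((ae_restrict_mem measurableSet_Ioc).mono hβ0) (Eventually.of_forall hsub)
    have hαy0 : ∀ s ∈ Ioc t₁ t, 0 ≤ α s * y s := fun s hs =>
      mul_nonneg (hα0 s (Ioc_subset_Icc_self (hsub hs))) (hy0 s)
    have e1 : ENNReal.ofReal (∫ s in Ioc t₁ t, α s * y s) = ∫⁻ s in Ioo t₁ t, a s * φ s := by
      rw [setLIntegral_congr Ioo_ae_eq_Ioc,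
        ofReal_integral_eq_lintegral_ofReal hαy' ((ae_restrict_mem measurableSet_Ioc).mono hαy0)]
      refine setLIntegral_congr_fun measurableSet_Ioc fun s hs => ?_
      rw [ha, hφ, ENNReal.ofReal_mul (hα0 s (Ioc_subset_Icc_self (hsub hs)))]
    calc φ t = ENNReal.ofReal (y t) := rfl
      _ ≤ ENNReal.ofReal (B + ∫ s in Ioc t₁ t, α s * y s) := ENNReal.ofReal_le_ofReal (by rw [hB_def]; linarith)
      _ = ENNReal.ofReal B + ∫⁻ s in Ioo t₁ t, a s * φ s := by
          rw [ENNReal.ofReal_add hB0 (setIntegral_nonneg measurableSet_Ioc hαy0), e1]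

/-- `∫_{(t₁,τ]} s^r ds ≤ τ^{r+1}/(r+1)` for `r > -1`, `0 < t₁ ≤ τ`, with integrability. [folklore] -/
theorem setIntegral_Ioc_rpow_le {t₁ τ r : ℝ} (ht₁ : 0 < t₁) (h1τ : t₁ ≤ τ) (hr : -1 < r) :
    IntegrableOn (fun s : ℝ => s ^ r) (Ioc t₁ τ) volume ∧
      ∫ s in Ioc t₁ τ, s ^ r ≤ τ ^ (r + 1) / (r + 1) := by
  have hcont : ContinuousOn (fun s : ℝ => s ^ r) (Icc t₁ τ) :=
    continuousOn_id.rpow_const fun _ hs => Or.inl (ht₁.trans_le hs.1).ne'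
  have hI : IntegrableOn (fun s : ℝ => s ^ r) (Ioc t₁ τ) volume :=
    (hcont.integrableOn_compact isCompact_Icc).mono_set Ioc_subset_Icc_self
  refine ⟨hI, ?_⟩
  rw [← intervalIntegral.integral_of_le h1τ, integral_rpow (Or.inl hr)]
  have h1 : 0 ≤ t₁ ^ (r + 1) := Real.rpow_nonneg ht₁.le _
  have hr1 : 0 < r + 1 := by linarith
  exact div_le_div_of_nonneg_right (by linarith) hr1.le

/-- Continuity of `t ↦ c * t^r * a` on `(0, ∞)`. [folklore] -/
theorem continuousOn_const_mul_rpow_mul (c r a : ℝ) :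
    ContinuousOn (fun t : ℝ => c * t ^ r * a) (Ioi 0) :=
  (continuousOn_const.mul (continuousOn_id.rpow_const fun _ ht => Or.inl (ne_of_gt ht))).mul
    continuousOn_const

/-- **Scaling bookkeeping** for the splitting height `N = τ^{-1/2}`, `0 < τ ≤ 1`:
from `A ≤ (10 N^{1/3} M)^{3/10}` and `B ≤ (3M/N)^{1/2}`:
`A τ^{1/20} ≤ 10^{3/10} M^{3/10}`, `A⁴ τ^{7/10} ≤ 10^{6/5} M^{6/5} τ^{1/2}`, `B² ≤ 3 M τ^{1/2}`. [folklore] -/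
theorem layer_bookkeeping {τ : ℝ} (hτ : 0 < τ) {M A Bt : ℝ} (hM : 0 ≤ M) (hA0 : 0 ≤ A) (hBt0 : 0 ≤ Bt)
    (hA : A ≤ (10 * (τ ^ (-(1 / 2 : ℝ))) ^ (1 / 3 : ℝ) * M) ^ (3 / 10 : ℝ))
    (hBt : Bt ≤ (3 / τ ^ (-(1 / 2 : ℝ)) * M) ^ (1 / 2 : ℝ)) :
    A * τ ^ (1 / 20 : ℝ) ≤ (10 : ℝ) ^ (3 / 10 : ℝ) * M ^ (3 / 10 : ℝ) ∧
    A ^ 4 * τ ^ (7 / 10 : ℝ) ≤ (10 : ℝ) ^ (6 / 5 : ℝ) * M ^ (6 / 5 : ℝ) * τ ^ (1 / 2 : ℝ) ∧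
    Bt ^ 2 ≤ 3 * M * τ ^ (1 / 2 : ℝ) := by
  have hτ0 := hτ.le
  -- `A ≤ 10^{3/10} τ^{-1/20} M^{3/10}`
  have e1 : (τ ^ (-(1 / 2 : ℝ))) ^ (1 / 3 : ℝ) = τ ^ (-(1 / 6 : ℝ)) := by
    rw [← Real.rpow_mul hτ0]; norm_num
  have hA' : A ≤ (10 : ℝ) ^ (3 / 10 : ℝ) * τ ^ (-(1 / 20 : ℝ)) * M ^ (3 / 10 : ℝ) := by
    refine hA.trans_eq ?_
    rw [e1, Real.mul_rpow (by positivity) hM, Real.mul_rpow (by norm_num) (Real.rpow_nonneg hτ0 _),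
      ← Real.rpow_mul hτ0]
    norm_num
  have hP : 0 ≤ (10 : ℝ) ^ (3 / 10 : ℝ) * M ^ (3 / 10 : ℝ) := by positivity
  refine ⟨?_, ?_, ?_⟩
  · calc A * τ ^ (1 / 20 : ℝ) ≤ ((10 : ℝ) ^ (3 / 10 : ℝ) * τ ^ (-(1 / 20 : ℝ)) * M ^ (3 / 10 : ℝ)) * τ ^ (1 / 20 : ℝ) :=
          mul_le_mul_of_nonneg_right hA' (Real.rpow_nonneg hτ0 _)
      _ = (10 : ℝ) ^ (3 / 10 : ℝ) * M ^ (3 / 10 : ℝ) * (τ ^ (-(1 / 20 : ℝ)) * τ ^ (1 / 20 : ℝ)) := by ring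
      _ = (10 : ℝ) ^ (3 / 10 : ℝ) * M ^ (3 / 10 : ℝ) := by
          rw [← Real.rpow_add hτ]; norm_num
  · have h4 : A ^ 4 ≤ ((10 : ℝ) ^ (3 / 10 : ℝ) * τ ^ (-(1 / 20 : ℝ)) * M ^ (3 / 10 : ℝ)) ^ 4 :=
      pow_le_pow_left₀ hA0 hA' 4
    have e4 : ((10 : ℝ) ^ (3 / 10 : ℝ) * τ ^ (-(1 / 20 : ℝ)) * M ^ (3 / 10 : ℝ)) ^ 4 =
        (10 : ℝ) ^ (6 / 5 : ℝ) * τ ^ (-(1 / 5 : ℝ)) * M ^ (6 / 5 : ℝ) := by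
      rw [mul_pow, mul_pow, ← Real.rpow_mul_natCast (by norm_num), ← Real.rpow_mul_natCast hτ0,
        ← Real.rpow_mul_natCast hM]
      norm_num
    calc A ^ 4 * τ ^ (7 / 10 : ℝ) ≤ ((10 : ℝ) ^ (6 / 5 : ℝ) * τ ^ (-(1 / 5 : ℝ)) * M ^ (6 / 5 : ℝ)) * τ ^ (7 / 10 : ℝ) := by
          rw [← e4]; exact mul_le_mul_of_nonneg_right h4 (Real.rpow_nonneg hτ0 _)
      _ = (10 : ℝ) ^ (6 / 5 : ℝ) * M ^ (6 / 5 : ℝ) * (τ ^ (-(1 / 5 : ℝ)) * τ ^ (7 / 10 : ℝ)) := by ring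
      _ = (10 : ℝ) ^ (6 / 5 : ℝ) * M ^ (6 / 5 : ℝ) * τ ^ (1 / 2 : ℝ) := by
          rw [← Real.rpow_add hτ]; norm_num
  · have e3 : 3 / τ ^ (-(1 / 2 : ℝ)) * M = 3 * M * τ ^ (1 / 2 : ℝ) := by
      rw [Real.rpow_neg hτ0, div_inv_eq_mul]; ring
    have h3 : 0 ≤ 3 * M * τ ^ (1 / 2 : ℝ) := by positivity
    calc Bt ^ 2 ≤ ((3 / τ ^ (-(1 / 2 : ℝ)) * M) ^ (1 / 2 : ℝ)) ^ 2 := pow_le_pow_left₀ hBt0 hBt 2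
      _ = 3 * M * τ ^ (1 / 2 : ℝ) := by
          rw [e3, ← Real.rpow_mul_natCast h3]
          norm_num

/-- `2M√y ≤ λy + M²/λ` for `λ > 0`, `y ≥ 0`. [folklore] -/
theorem two_mul_mul_sqrt_le {Mt lam y : ℝ} (hlam : 0 < lam) (hy : 0 ≤ y) :
    2 * (Mt * Real.sqrt y) ≤ lam * y + Mt ^ 2 / lam := by
  have hl : Real.sqrt lam ^ 2 = lam := Real.sq_sqrt hlam.le
  have hyy : Real.sqrt y ^ 2 = y := Real.sq_sqrt hy
  have hsl : 0 < Real.sqrt lam := Real.sqrt_pos.2 hlam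
  have key := two_mul_le_add_sq (Mt / Real.sqrt lam) (Real.sqrt lam * Real.sqrt y)
  have e1 : Mt / Real.sqrt lam * (Real.sqrt lam * Real.sqrt y) = Mt * Real.sqrt y := by
    field_simp
  have e2 : (Mt / Real.sqrt lam) ^ 2 = Mt ^ 2 / lam := by
    rw [div_pow, hl]
  have e3 : (Real.sqrt lam * Real.sqrt y) ^ 2 = lam * y := by rw [mul_pow, hl, hyy]
  rw [mul_assoc, e1, e2, e3] at key
  linarith

/-! ### The core estimate for a given splitting -/

variable {S : ℝ} {u : ℝ → EuclideanSpace ℝ (Fin 3) → EuclideanSpace ℝ (Fin 3)}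
set_option maxHeartbeats 400000 in -- buildfix (bf3-g26): 160k/180k FAIL, 200k PASS at accept time; line-neutral budget line
/-- **The energy estimate of BSS Lemma 3.4 for a given splitting `u(0) = ḡ + g̃`.** Let `u` be a
bounded, jointly continuous, weakly divergence-free solution of the Oseen integral equation on
`[0, S] × ℝ³`, `S ≤ 1`, with `u(0) ∈ L⁴ ∩ L^{3,∞}`, and let `u(0) = ḡ + g̃` with `ḡ ∈ L^{10/3}`,
`|ḡ| ≤ N`, `g̃ ∈ L²` bounded. With `A = ‖ḡ‖_{10/3}`, `B = ‖g̃‖₂`, `c₁ = 2‖tr‖² + 3` and the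
absolute constant `C` of `caloricField_bounds`, for every `τ ∈ (0, S)`:
`‖u(τ) − e^{τΔ}u(0)‖₂ ≤ ((c₁B)² + (20/9)C⁴A⁴τ^{7/10})^{1/2} exp(20CAτ^{1/20} + 2) + c₁B`
(global energy inequality for `w = u − E`, `E` the caloric field of `ḡ`, linearised and closed
by Grönwall on `[t₁, τ]`, `t₁ → 0`; then `u − e^{τΔ}u(0) = w − (e^{τΔ}g̃ − ∫_τ^∞∇div e^{σΔ}ḡ)`).
[cite: BarkerSeregin2016, Lemma 3.4 (proof)] -/
theorem eLpNorm_sub_heatExtension_le_of_splitting (hS : 0 < S)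
    (hcont : ContinuousOn (uncurry u) (Icc 0 S ×ˢ univ)) {K : ℝ}
    (hK : ∀ t ∈ Icc 0 S, ∀ x, ‖u t x‖ ≤ K) (hdiv : ∀ t ∈ Icc 0 S, IsWeaklyDivFree (u t))
    (hmild : ∀ s t : ℝ, 0 ≤ s → s < t → t ≤ S → ∀ x,
      u t x = heatExtension (u s) (t - s) x - oseenDuhamel 1 s u u t x)
    (h0 : MemWeakLp (u 0) 3 volume) (h4 : MemLp (u 0) 4 volume)
    {C : ℝ} (hC0 : 0 ≤ C)
    (hCF : ∀ (gb : EuclideanSpace ℝ (Fin 3) → EuclideanSpace ℝ (Fin 3)) (N : ℝ),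
      MemLp gb (10 / 3) volume → (∀ z, ‖gb z‖ ≤ N) → ∀ t : ℝ, 0 < t →
      (∀ x, ‖heatExtension gb t x + ∫ σ in Ioi t, gradient (VectorCalculus.divergence (heatExtension gb σ)) x‖ ≤
        N + C * t ^ (-(9 / 20 : ℝ)) * (eLpNorm gb (10 / 3) volume).toReal) ∧
      (∀ x, ‖fderiv ℝ (fun y => heatExtension gb t y +
          ∫ σ in Ioi t, gradient (VectorCalculus.divergence (heatExtension gb σ)) y) x‖ ≤
        C * t ^ (-(19 / 20 : ℝ)) * (eLpNorm gb (10 / 3) volume).toReal) ∧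
      MemLp (fun x => heatExtension gb t x +
          ∫ σ in Ioi t, gradient (VectorCalculus.divergence (heatExtension gb σ)) x) 4 volume ∧
      eLpNorm (fun x => heatExtension gb t x +
          ∫ σ in Ioi t, gradient (VectorCalculus.divergence (heatExtension gb σ)) x) 4 volume ≤
        ENNReal.ofReal (C * t ^ (-(3 / 40 : ℝ))) * eLpNorm gb (10 / 3) volume ∧
      eLpNorm (fderiv ℝ (fun x => heatExtension gb t x +
          ∫ σ in Ioi t, gradient (VectorCalculus.divergence (heatExtension gb σ)) x)) 4 volume ≤
        ENNReal.ofReal (C * t ^ (-(23 / 40 : ℝ))) * eLpNorm gb (10 / 3) volume)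
    {gb gt : EuclideanSpace ℝ (Fin 3) → EuclideanSpace ℝ (Fin 3)} (hsum : ∀ x, u 0 x = gb x + gt x)
    {N : ℝ} (hgbN : ∀ x, ‖gb x‖ ≤ N) (hgtK : ∀ x, ‖gt x‖ ≤ K)
    (hgb : MemLp gb (10 / 3) volume) (hgt : MemLp gt 2 volume) {τ : ℝ} (hτ : τ ∈ Ioo 0 S) :
    MemLp (fun x => u τ x - heatExtension (u 0) τ x) 2 volume ∧
    (eLpNorm (fun x => u τ x - heatExtension (u 0) τ x) 2 volume).toReal ≤
      Real.sqrt ((((2 * ‖(traceCLM : (EuclideanSpace ℝ (Fin 3) →L[ℝ] EuclideanSpace ℝ (Fin 3)) →L[ℝ] ℝ)‖ ^ 2 + 3) *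
          (eLpNorm gt 2 volume).toReal) ^ 2 +
        20 / 9 * C ^ 4 * (eLpNorm gb (10 / 3) volume).toReal ^ 4 * τ ^ (7 / 10 : ℝ)) *
        Real.exp (40 * C * (eLpNorm gb (10 / 3) volume).toReal * τ ^ (1 / 20 : ℝ) + 4)) +
      (2 * ‖(traceCLM : (EuclideanSpace ℝ (Fin 3) →L[ℝ] EuclideanSpace ℝ (Fin 3)) →L[ℝ] ℝ)‖ ^ 2 + 3) *
        (eLpNorm gt 2 volume).toReal := by
  haveI : ENNReal.HolderTriple (4 : ℝ≥0∞) 4 2 := holderTriple_four_four_two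
  -- names for the constants
  set c₁ : ℝ := 2 * ‖(traceCLM : (EuclideanSpace ℝ (Fin 3) →L[ℝ] EuclideanSpace ℝ (Fin 3)) →L[ℝ] ℝ)‖ ^ 2 + 3 with hc₁
  have hc₁0 : 0 ≤ c₁ := by positivity
  set A : ℝ := (eLpNorm gb (10 / 3) volume).toReal with hA_def
  set Bt : ℝ := (eLpNorm gt 2 volume).toReal with hBt_def
  have hA0 : 0 ≤ A := ENNReal.toReal_nonneg
  have hBt0 : 0 ≤ Bt := ENNReal.toReal_nonneg
  have hτ0 : 0 < τ := hτ.1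
  have hAeq : eLpNorm gb (10 / 3) volume = ENNReal.ofReal A := (ENNReal.ofReal_toReal hgb.2.ne).symm
  have hBteq : eLpNorm gt 2 volume = ENNReal.ofReal Bt := (ENNReal.ofReal_toReal hgt.2.ne).symm
  -- the caloric field of `ḡ`
  set E' : ℝ → EuclideanSpace ℝ (Fin 3) → EuclideanSpace ℝ (Fin 3) := fun t x =>
    heatExtension gb t x + ∫ σ in Ioi t, gradient (VectorCalculus.divergence (heatExtension gb σ)) x with hE'
  obtain ⟨hc1, hc2, hc3⟩ := continuousOn_caloricField_uncurry hgb hgbN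
  have hEc : ContinuousOn (fun q : ℝ × EuclideanSpace ℝ (Fin 3) => E' q.1 q.2) (Ioi 0 ×ˢ univ) := hc1
  have hEDc : ContinuousOn (fun q : ℝ × EuclideanSpace ℝ (Fin 3) => fderiv ℝ (E' q.1) q.2) (Ioi 0 ×ˢ univ) := hc2
  have hEΔc : ContinuousOn (fun q : ℝ × EuclideanSpace ℝ (Fin 3) => (Δ (E' q.1)) q.2) (Ioi 0 ×ˢ univ) := hc3
  have hEsm : ∀ t, 0 < t → ContDiff ℝ 2 (E' t) := fun t ht =>
    contDiff_infty.1 (contDiff_caloricField hgb hgbN ht) 2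
  have hEdiv : ∀ t, 0 < t → VectorCalculus.IsDivFree (E' t) := fun t ht => isDivFree_caloricField hgb hgbN ht
  have hEt : ∀ t, 0 < t → ∀ x, HasDerivAt (fun s => E' s x) ((Δ (E' t)) x) t := fun t ht x =>
    hasDerivAt_caloricField hgb hgbN ht x
  have hbd : ∀ t, 0 < t → (∀ x, ‖E' t x‖ ≤ N + C * t ^ (-(9 / 20 : ℝ)) * A) ∧
      (∀ x, ‖fderiv ℝ (E' t) x‖ ≤ C * t ^ (-(19 / 20 : ℝ)) * A) ∧ MemLp (E' t) 4 volume ∧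
      eLpNorm (E' t) 4 volume ≤ ENNReal.ofReal (C * t ^ (-(3 / 40 : ℝ))) * eLpNorm gb (10 / 3) volume ∧
      eLpNorm (fderiv ℝ (E' t)) 4 volume ≤ ENNReal.ofReal (C * t ^ (-(23 / 40 : ℝ))) * eLpNorm gb (10 / 3) volume :=
    fun t ht => hCF gb N hgb hgbN t ht
  -- window bounds of `E`, `∇E`
  have hEB : ∀ δ : ℝ, 0 < δ → ∃ B : ℝ, ∀ t ∈ Ico δ S, ∀ x, ‖E' t x‖ ≤ B ∧ ‖fderiv ℝ (E' t) x‖ ≤ B := by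
    intro δ hδ
    refine ⟨max (N + C * δ ^ (-(9 / 20 : ℝ)) * A) (C * δ ^ (-(19 / 20 : ℝ)) * A), fun t ht x => ?_⟩
    have ht0 : 0 < t := hδ.trans_le ht.1
    obtain ⟨h1, h2, -, -, -⟩ := hbd t ht0
    have hp1 : t ^ (-(9 / 20 : ℝ)) ≤ δ ^ (-(9 / 20 : ℝ)) :=
      Real.rpow_le_rpow_of_nonpos hδ ht.1 (by norm_num)
    have hp2 : t ^ (-(19 / 20 : ℝ)) ≤ δ ^ (-(19 / 20 : ℝ)) :=
      Real.rpow_le_rpow_of_nonpos hδ ht.1 (by norm_num)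
    refine ⟨(h1 x).trans ((le_max_left _ _).trans' ?_), (h2 x).trans ((le_max_right _ _).trans' ?_)⟩
    · have : C * t ^ (-(9 / 20 : ℝ)) * A ≤ C * δ ^ (-(9 / 20 : ℝ)) * A := by gcongr
      linarith
    · gcongr
  -- the kernels `D`, `M`
  set D : ℝ → ℝ := fun t => C * t ^ (-(19 / 20 : ℝ)) * A with hD_def
  set Mf : ℝ → ℝ := fun t => (C * |t| ^ (-(23 / 40 : ℝ)) * A) * (C * |t| ^ (-(3 / 40 : ℝ)) * A) with hMf_def
  have hDc : ContinuousOn D (Ioi 0) := continuousOn_const_mul_rpow_mul C _ A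
  have hMc : ContinuousOn Mf (Ioi 0) := by
    have h1 : ∀ r : ℝ, ContinuousOn (fun t : ℝ => C * |t| ^ r * A) (Ioi 0) := fun r =>
      (continuousOn_const.mul ((continuous_abs.continuousOn).rpow_const fun t ht =>
        Or.inl (abs_pos.2 (ne_of_gt ht)).ne')).mul continuousOn_const
    exact (h1 _).mul (h1 _)
  have hMf0 : ∀ t, 0 ≤ Mf t := fun t => by
    simp only [hMf_def]
    have h1 : ∀ r : ℝ, 0 ≤ C * |t| ^ r * A := fun r =>
      mul_nonneg (mul_nonneg hC0 (Real.rpow_nonneg (abs_nonneg t) _)) hA0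
    exact mul_nonneg (h1 _) (h1 _)
  have hD : ∀ t ∈ Ioo 0 S, ∀ x, ‖fderiv ℝ (E' t) x‖ ≤ D t := fun t ht x => (hbd t ht.1).2.1 x
  have hME : ∀ t ∈ Ioo 0 S, MemLp (fun x => ‖fderiv ℝ (E' t) x‖ * ‖E' t x‖) 2 volume ∧
      ∫ x, (‖fderiv ℝ (E' t) x‖ * ‖E' t x‖) ^ 2 ≤ Mf t ^ 2 := by
    intro t ht
    obtain ⟨-, -, hE4, hE4le, hDE4le⟩ := hbd t ht.1
    have hslice := hEDc.comp_continuous (f := fun x : EuclideanSpace ℝ (Fin 3) => (t, x)) (by fun_prop)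
      fun x => ⟨ht.1, mem_univ _⟩
    have hDEm : AEStronglyMeasurable (fderiv ℝ (E' t)) volume := (hslice : Continuous _).aestronglyMeasurable
    have hle : eLpNorm (fun x => ‖fderiv ℝ (E' t) x‖ * ‖E' t x‖) 2 volume ≤
        eLpNorm (fderiv ℝ (E' t)) 4 volume * eLpNorm (E' t) 4 volume := by
      have h := eLpNorm_smul_le_mul_eLpNorm (p := 4) (q := 4) (r := 2) hE4.1.norm hDEm.norm
        (μ := (volume : Measure (EuclideanSpace ℝ (Fin 3))))
      rw [eLpNorm_norm, eLpNorm_norm] at h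
      exact h
    have hfin : eLpNorm (fderiv ℝ (E' t)) 4 volume * eLpNorm (E' t) 4 volume ≤
        ENNReal.ofReal (Mf t) := by
      have habs : |t| = t := abs_of_pos ht.1
      calc eLpNorm (fderiv ℝ (E' t)) 4 volume * eLpNorm (E' t) 4 volume
          ≤ (ENNReal.ofReal (C * t ^ (-(23 / 40 : ℝ))) * eLpNorm gb (10 / 3) volume) *
              (ENNReal.ofReal (C * t ^ (-(3 / 40 : ℝ))) * eLpNorm gb (10 / 3) volume) :=
            mul_le_mul' hDE4le hE4le
        _ = ENNReal.ofReal (Mf t) := by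
            have hp1 : 0 ≤ C * t ^ (-(23 / 40 : ℝ)) := mul_nonneg hC0 (Real.rpow_nonneg ht.1.le _)
            have hp2 : 0 ≤ C * t ^ (-(3 / 40 : ℝ)) := mul_nonneg hC0 (Real.rpow_nonneg ht.1.le _)
            rw [hAeq, ← ENNReal.ofReal_mul hp1, ← ENNReal.ofReal_mul hp2,
              ← ENNReal.ofReal_mul (mul_nonneg hp1 hA0)]
            simp only [hMf_def, habs]
    have hmeas : AEStronglyMeasurable (fun x => ‖fderiv ℝ (E' t) x‖ * ‖E' t x‖) volume :=
      hDEm.norm.mul hE4.1.norm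
    have hmem : MemLp (fun x => ‖fderiv ℝ (E' t) x‖ * ‖E' t x‖) 2 volume :=
      ⟨hmeas, (hle.trans hfin).trans_lt ENNReal.ofReal_lt_top⟩
    refine ⟨hmem, ?_⟩
    have h2 := toReal_eLpNorm_two_sq_eq_integral hmem
    simp only [Real.norm_eq_abs, abs_mul, abs_norm] at h2
    rw [← h2]
    have h3 : (eLpNorm (fun x => ‖fderiv ℝ (E' t) x‖ * ‖E' t x‖) 2 volume).toReal ≤ Mf t := by
      have := ENNReal.toReal_mono ENNReal.ofReal_ne_top (hle.trans hfin)
      rwa [ENNReal.toReal_ofReal (hMf0 t)] at this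
    exact pow_le_pow_left₀ ENNReal.toReal_nonneg h3 2
  -- the Riesz pressure and the Navier–Stokes equations on the slab
  obtain ⟨p, -, hp2, -, hsuit⟩ := exists_rieszPressure_suitable_slab_of_oseenForward hS hcont hK hdiv hmild h0
  have hNS := hsuit.distributional
  -- the remainder `u - e^{tΔ}u(0)` and the caloric remainder `e^{tΔ}u(0) - E`
  obtain ⟨C₁, hC₁0, hU⟩ := eLpNorm_two_sub_heatExtension_le_of_oseenForward hS hcont hK hmild h4
  have hu0 : u 0 = gb + gt := funext fun x => by rw [hsum x]; rfl
  have hdiv0 : IsWeaklyDivFree (gb + gt) := by rw [← hu0]; exact hdiv 0 ⟨le_rfl, hS.le⟩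
  have hWt : ∀ t, 0 < t → MemLp (fun x => heatExtension (u 0) t x - E' t x) 2 volume ∧
      eLpNorm (fun x => heatExtension (u 0) t x - E' t x) 2 volume ≤ ENNReal.ofReal (c₁ * Bt) := by
    intro t ht
    obtain ⟨hid, hmem, hle⟩ := eLpNorm_heatExtension_sub_caloricField_le hgb hgbN hgt hgtK hdiv0 ht
    have hfun : (fun x => heatExtension (u 0) t x - E' t x) =
        fun x => heatExtension gt t x - ∫ σ in Ioi t, gradient (VectorCalculus.divergence (heatExtension gb σ)) x := by
      funext x; rw [hu0]; exact hid x
    rw [hfun]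
    refine ⟨hmem, hle.trans_eq ?_⟩
    rw [hBteq, ← ENNReal.ofReal_mul hc₁0]
  have hwt : ∀ t ∈ Ioo 0 S, MemLp (fun x => u t x - E' t x) 2 volume ∧
      ∫ x, ‖u t x - E' t x‖ ^ 2 ≤ (C₁ * Real.sqrt t + c₁ * Bt) ^ 2 := by
    intro t ht
    obtain ⟨hUm, hUle⟩ := hU t ⟨ht.1, ht.2.le⟩
    obtain ⟨hWm, hWle⟩ := hWt t ht.1
    have hsum' : (fun x => u t x - E' t x) =
        fun x => (u t x - heatExtension (u 0) t x) + (heatExtension (u 0) t x - E' t x) := by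
      funext x; abel
    have hmem : MemLp (fun x => u t x - E' t x) 2 volume := by rw [hsum']; exact hUm.add hWm
    refine ⟨hmem, ?_⟩
    have hle : eLpNorm (fun x => u t x - E' t x) 2 volume ≤ ENNReal.ofReal (C₁ * Real.sqrt t + c₁ * Bt) := by
      rw [hsum']
      refine (eLpNorm_add_le hUm.1 hWm.1 one_le_two).trans ?_
      rw [ENNReal.ofReal_add (by positivity) (by positivity)]
      exact add_le_add hUle hWle
    rw [← toReal_eLpNorm_two_sq_eq_integral hmem]
    have := ENNReal.toReal_mono ENNReal.ofReal_ne_top hle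
    rw [ENNReal.toReal_ofReal (by positivity)] at this
    exact pow_le_pow_left₀ ENNReal.toReal_nonneg this 2
  have hw : ∀ δ : ℝ, 0 < δ → ∃ Bw : ℝ, ∀ t ∈ Ioo δ S,
      MemLp (fun x => u t x - E' t x) 2 volume ∧ ∫ x, ‖u t x - E' t x‖ ^ 2 ≤ Bw := by
    intro δ hδ
    refine ⟨(C₁ * Real.sqrt S + c₁ * Bt) ^ 2, fun t ht => ?_⟩
    obtain ⟨hmem, hle⟩ := hwt t ⟨hδ.trans ht.1, ht.2⟩
    refine ⟨hmem, hle.trans ?_⟩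
    gcongr
    exact ht.2.le
  -- ### the global energy inequality
  obtain ⟨hymeas, hGB⟩ := remainder_energy_inequality hS hcont hK hdiv hmild hEc hEDc hEΔc hEsm hEdiv hEt
    hEB hNS hp2 hw hDc hMc hMf0 hD hME
  set y : ℝ → ℝ := fun t => ∫ x, ‖u t x - E' t x‖ ^ 2 with hy_def
  have hy0 : ∀ t, 0 ≤ y t := fun t => integral_nonneg fun x => by positivity
  -- ### linearisation and Grönwall on `[t₁, τ]`
  set lam : ℝ → ℝ := fun s => τ ^ (-(1 / 4 : ℝ)) * s ^ (-(3 / 4 : ℝ)) with hlam_def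
  set α : ℝ → ℝ := fun s => 2 * D s + lam s with hα_def
  set β : ℝ → ℝ := fun s => Mf s ^ 2 / lam s with hβ_def
  have hlam0 : ∀ s, 0 < s → 0 < lam s := fun s hs =>
    mul_pos (Real.rpow_pos_of_pos hτ0 _) (Real.rpow_pos_of_pos hs _)
  have hD0 : ∀ s, 0 < s → 0 ≤ D s := fun s hs =>
    mul_nonneg (mul_nonneg hC0 (Real.rpow_nonneg hs.le _)) hA0
  have hlamc : ContinuousOn lam (Ioi 0) :=
    continuousOn_const.mul (continuousOn_id.rpow_const fun _ ht => Or.inl (ne_of_gt ht))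
  have hαc : ContinuousOn α (Ioi 0) := (continuousOn_const.mul hDc).add hlamc
  have hβc : ContinuousOn β (Ioi 0) := (hMc.pow 2).div hlamc fun s hs => (hlam0 s hs).ne'
  have hGr : ∀ t₁, 0 < t₁ → t₁ ≤ τ →
      y τ ≤ (y t₁ + ∫ s in Ioc t₁ τ, β s) * Real.exp (∫ s in Ioc t₁ τ, α s) := by
    intro t₁ ht₁ h1τ
    have hIcc : Icc t₁ τ ⊆ Ioi 0 := fun s hs => ht₁.trans_le hs.1
    have hIccS : Icc t₁ τ ⊆ Ioo 0 S := fun s hs => ⟨ht₁.trans_le hs.1, hs.2.trans_lt hτ.2⟩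
    obtain ⟨Bw, hBw⟩ := hw (t₁ / 2) (by positivity)
    have hyB : ∀ s ∈ Icc t₁ τ, y s ≤ Bw := fun s hs =>
      (hBw s ⟨by linarith [hs.1], hs.2.trans_lt hτ.2⟩).2
    have hym : AEStronglyMeasurable y (volume.restrict (Ioc t₁ τ)) :=
      hymeas.mono_measure (Measure.restrict_mono (Ioc_subset_Icc_self.trans hIccS) le_rfl)
    haveI : IsFiniteMeasure ((volume : Measure ℝ).restrict (Ioc t₁ τ)) :=
      isFiniteMeasure_restrict.2 measure_Ioc_lt_top.ne
    -- integrability of `α y` and `β` on `(t₁, τ]`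
    obtain ⟨Aα, hAα⟩ := isCompact_Icc.exists_bound_of_continuousOn (hαc.mono hIcc)
    have hBw0 : 0 ≤ Bw := (hy0 t₁).trans (hyB t₁ ⟨le_rfl, h1τ⟩)
    have hαyI : IntegrableOn (fun s => α s * y s) (Ioc t₁ τ) volume := by
      refine ⟨((hαc.mono (Ioc_subset_Icc_self.trans hIcc)).aestronglyMeasurable measurableSet_Ioc).mul hym,
        HasFiniteIntegral.of_bounded (C := Aα * Bw) ?_⟩
      filter_upwards [ae_restrict_mem measurableSet_Ioc] with s hs
      rw [norm_mul, Real.norm_of_nonneg (hy0 s)]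
      exact mul_le_mul (hAα s (Ioc_subset_Icc_self hs)) (hyB s (Ioc_subset_Icc_self hs)) (hy0 s)
        ((norm_nonneg _).trans (hAα s (Ioc_subset_Icc_self hs)))
    have hβI : IntegrableOn β (Ioc t₁ τ) volume :=
      ((hβc.mono hIcc).integrableOn_compact isCompact_Icc).mono_set Ioc_subset_Icc_self
    refine gronwall_real_Icc h1τ hy0 hyB hym (hαc.mono hIcc)
      (fun s hs => add_nonneg (mul_nonneg zero_le_two (hD0 s (hIcc hs))) (hlam0 s (hIcc hs)).le) hβI
      (fun s hs => div_nonneg (sq_nonneg _) (hlam0 s (hIcc (Ioc_subset_Icc_self hs))).le) ?_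
    -- the linearised inequality on `[t₁, t]`
    intro t ht
    rcases eq_or_lt_of_le ht.1 with heq | hlt
    · subst heq; simp
    obtain ⟨hbint, hineq⟩ := hGB ht₁ ht.1 (ht.2.trans_lt hτ.2)
    have hsub : Ioc t₁ t ⊆ Ioc t₁ τ := Ioc_subset_Ioc_right ht.2
    have h2b : 2 * ∫ s in Ioc t₁ t, (D s * (∫ x, ‖u s x - E' s x‖ ^ 2) +
        Mf s * Real.sqrt (∫ x, ‖u s x - E' s x‖ ^ 2)) ≤ ∫ s in Ioc t₁ t, (α s * y s + β s) := by
      rw [← integral_const_mul]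
      refine setIntegral_mono_on (hbint.const_mul 2) ((hαyI.add hβI).mono_set hsub) measurableSet_Ioc
        fun s hs => ?_
      have hs0 : 0 < s := ht₁.trans hs.1
      have key := two_mul_mul_sqrt_le (Mt := Mf s) (hlam0 s hs0) (hy0 s)
      simp only [hα_def, hβ_def, hy_def] at key ⊢
      nlinarith [key, hD0 s hs0, hy0 s]
    linarith
  -- ### the explicit integrals
  have hIα : ∀ t₁, 0 < t₁ → t₁ ≤ τ → ∫ s in Ioc t₁ τ, α s ≤ 40 * C * A * τ ^ (1 / 20 : ℝ) + 4 := by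
    intro t₁ ht₁ h1τ
    obtain ⟨i1, h1⟩ := setIntegral_Ioc_rpow_le (r := -(19 / 20 : ℝ)) ht₁ h1τ (by norm_num)
    obtain ⟨i2, h2⟩ := setIntegral_Ioc_rpow_le (r := -(3 / 4 : ℝ)) ht₁ h1τ (by norm_num)
    have e : ∀ s, α s = (2 * C * A) * s ^ (-(19 / 20 : ℝ)) + τ ^ (-(1 / 4 : ℝ)) * s ^ (-(3 / 4 : ℝ)) := by
      intro s; simp only [hα_def, hD_def, hlam_def]; ring
    simp_rw [e]
    rw [integral_add (i1.const_mul _) (i2.const_mul _), integral_const_mul, integral_const_mul]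
    have e1 : (-(19 / 20 : ℝ)) + 1 = 1 / 20 := by norm_num
    have e2 : (-(3 / 4 : ℝ)) + 1 = 1 / 4 := by norm_num
    rw [e1] at h1
    rw [e2] at h2
    have hτ14 : τ ^ (-(1 / 4 : ℝ)) * (τ ^ (1 / 4 : ℝ) / (1 / 4)) = 4 := by
      rw [mul_div_assoc', ← Real.rpow_add hτ0]; norm_num
    have h3 : τ ^ (-(1 / 4 : ℝ)) * ∫ s in Ioc t₁ τ, s ^ (-(3 / 4 : ℝ)) ≤ 4 :=
      calc τ ^ (-(1 / 4 : ℝ)) * ∫ s in Ioc t₁ τ, s ^ (-(3 / 4 : ℝ))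
          ≤ τ ^ (-(1 / 4 : ℝ)) * (τ ^ (1 / 4 : ℝ) / (1 / 4)) :=
            mul_le_mul_of_nonneg_left h2 (Real.rpow_nonneg hτ0.le _)
        _ = 4 := hτ14
    have h4 : (2 * C * A) * ∫ s in Ioc t₁ τ, s ^ (-(19 / 20 : ℝ)) ≤ (2 * C * A) * (τ ^ (1 / 20 : ℝ) / (1 / 20)) :=
      mul_le_mul_of_nonneg_left h1 (by positivity)
    linarith
  have hIβ : ∀ t₁, 0 < t₁ → t₁ ≤ τ → ∫ s in Ioc t₁ τ, β s ≤ 20 / 9 * C ^ 4 * A ^ 4 * τ ^ (7 / 10 : ℝ) := by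
    intro t₁ ht₁ h1τ
    obtain ⟨i1, h1⟩ := setIntegral_Ioc_rpow_le (r := -(11 / 20 : ℝ)) ht₁ h1τ (by norm_num)
    have e : ∀ s ∈ Ioc t₁ τ, β s = (C ^ 4 * A ^ 4 * τ ^ (1 / 4 : ℝ)) * s ^ (-(11 / 20 : ℝ)) := by
      intro s hs
      have hs0 : 0 < s := ht₁.trans hs.1
      simp only [hβ_def, hMf_def, hlam_def, abs_of_pos hs0]
      have em : (C * s ^ (-(23 / 40 : ℝ)) * A) * (C * s ^ (-(3 / 40 : ℝ)) * A) = C ^ 2 * A ^ 2 * s ^ (-(13 / 20 : ℝ)) := by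
        have : s ^ (-(23 / 40 : ℝ)) * s ^ (-(3 / 40 : ℝ)) = s ^ (-(13 / 20 : ℝ)) := by
          rw [← Real.rpow_add hs0]; norm_num
        calc (C * s ^ (-(23 / 40 : ℝ)) * A) * (C * s ^ (-(3 / 40 : ℝ)) * A)
            = C ^ 2 * A ^ 2 * (s ^ (-(23 / 40 : ℝ)) * s ^ (-(3 / 40 : ℝ))) := by ring
          _ = C ^ 2 * A ^ 2 * s ^ (-(13 / 20 : ℝ)) := by rw [this]
      rw [em]
      have e2 : (C ^ 2 * A ^ 2 * s ^ (-(13 / 20 : ℝ))) ^ 2 = C ^ 4 * A ^ 4 * s ^ (-(13 / 10 : ℝ)) := by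
        have hp : (s ^ (-(13 / 20 : ℝ))) ^ 2 = s ^ (-(13 / 10 : ℝ)) := by
          rw [← Real.rpow_mul_natCast hs0.le]; norm_num
        rw [mul_pow, mul_pow, hp]; ring
      rw [e2, div_eq_mul_inv, mul_inv, ← Real.rpow_neg hτ0.le, ← Real.rpow_neg hs0.le, neg_neg, neg_neg]
      have e3 : s ^ (-(13 / 10 : ℝ)) * s ^ (3 / 4 : ℝ) = s ^ (-(11 / 20 : ℝ)) := by
        rw [← Real.rpow_add hs0]; norm_num
      calc C ^ 4 * A ^ 4 * s ^ (-(13 / 10 : ℝ)) * (τ ^ (1 / 4 : ℝ) * s ^ (3 / 4 : ℝ))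
          = C ^ 4 * A ^ 4 * τ ^ (1 / 4 : ℝ) * (s ^ (-(13 / 10 : ℝ)) * s ^ (3 / 4 : ℝ)) := by ring
        _ = C ^ 4 * A ^ 4 * τ ^ (1 / 4 : ℝ) * s ^ (-(11 / 20 : ℝ)) := by rw [e3]
    rw [setIntegral_congr_fun measurableSet_Ioc e, integral_const_mul]
    have e1 : (-(11 / 20 : ℝ)) + 1 = 9 / 20 := by norm_num
    rw [e1] at h1
    have hτe : τ ^ (1 / 4 : ℝ) * (τ ^ (9 / 20 : ℝ) / (9 / 20)) = 20 / 9 * τ ^ (7 / 10 : ℝ) := by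
      rw [mul_div_assoc', ← Real.rpow_add hτ0]; norm_num; ring
    calc C ^ 4 * A ^ 4 * τ ^ (1 / 4 : ℝ) * ∫ s in Ioc t₁ τ, s ^ (-(11 / 20 : ℝ))
        ≤ C ^ 4 * A ^ 4 * τ ^ (1 / 4 : ℝ) * (τ ^ (9 / 20 : ℝ) / (9 / 20)) :=
          mul_le_mul_of_nonneg_left h1 (by positivity)
      _ = C ^ 4 * A ^ 4 * (τ ^ (1 / 4 : ℝ) * (τ ^ (9 / 20 : ℝ) / (9 / 20))) := by ring
      _ = 20 / 9 * C ^ 4 * A ^ 4 * τ ^ (7 / 10 : ℝ) := by rw [hτe]; ring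
  -- ### `y(τ) ≤ F(t₁)` for all `t₁ ∈ (0, τ]`, and `t₁ → 0`
  set Iβ : ℝ := 20 / 9 * C ^ 4 * A ^ 4 * τ ^ (7 / 10 : ℝ) with hIβ_def
  set Iα : ℝ := 40 * C * A * τ ^ (1 / 20 : ℝ) + 4 with hIα_def
  have hIβ0 : 0 ≤ Iβ := by positivity
  have hF : ∀ t₁, 0 < t₁ → t₁ ≤ τ →
      y τ ≤ ((C₁ * Real.sqrt t₁ + c₁ * Bt) ^ 2 + Iβ) * Real.exp Iα := by
    intro t₁ ht₁ h1τ
    have hyt₁ : y t₁ ≤ (C₁ * Real.sqrt t₁ + c₁ * Bt) ^ 2 := (hwt t₁ ⟨ht₁, h1τ.trans_lt hτ.2⟩).2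
    have hβ0' : 0 ≤ ∫ s in Ioc t₁ τ, β s := setIntegral_nonneg measurableSet_Ioc fun s hs =>
      div_nonneg (sq_nonneg _) (hlam0 s (ht₁.trans hs.1)).le
    calc y τ ≤ (y t₁ + ∫ s in Ioc t₁ τ, β s) * Real.exp (∫ s in Ioc t₁ τ, α s) := hGr t₁ ht₁ h1τ
      _ ≤ ((C₁ * Real.sqrt t₁ + c₁ * Bt) ^ 2 + Iβ) * Real.exp Iα := by
          refine mul_le_mul (add_le_add hyt₁ (hIβ t₁ ht₁ h1τ)) (Real.exp_le_exp.2 (hIα t₁ ht₁ h1τ))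
            (Real.exp_pos _).le (by positivity)
  have hyτ : y τ ≤ ((c₁ * Bt) ^ 2 + Iβ) * Real.exp Iα := by
    have hcontF : Continuous fun t₁ : ℝ => ((C₁ * Real.sqrt t₁ + c₁ * Bt) ^ 2 + Iβ) * Real.exp Iα := by
      fun_prop
    have hlim : Tendsto (fun t₁ : ℝ => ((C₁ * Real.sqrt t₁ + c₁ * Bt) ^ 2 + Iβ) * Real.exp Iα) (𝓝[>] 0)
        (𝓝 (((C₁ * Real.sqrt 0 + c₁ * Bt) ^ 2 + Iβ) * Real.exp Iα)) :=
      (hcontF.tendsto 0).mono_left nhdsWithin_le_nhds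
    rw [Real.sqrt_zero, mul_zero, zero_add] at hlim
    refine ge_of_tendsto hlim ?_
    filter_upwards [Ioo_mem_nhdsGT hτ0] with t₁ ht₁
    exact hF t₁ ht₁.1 ht₁.2.le
  -- ### conclusion
  obtain ⟨hUm, -⟩ := hU τ ⟨hτ0, hτ.2.le⟩
  obtain ⟨hwm, -⟩ := hwt τ hτ
  obtain ⟨hWm, hWle⟩ := hWt τ hτ0
  refine ⟨hUm, ?_⟩
  have hUeq : (fun x => u τ x - heatExtension (u 0) τ x) =
      fun x => (u τ x - E' τ x) - (heatExtension (u 0) τ x - E' τ x) := by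
    funext x; abel
  have hfinw : eLpNorm (fun x => u τ x - E' τ x) 2 volume ≠ ⊤ := hwm.2.ne
  have hfinW : eLpNorm (fun x => heatExtension (u 0) τ x - E' τ x) 2 volume ≠ ⊤ := hWm.2.ne
  have hsqrt : (eLpNorm (fun x => u τ x - E' τ x) 2 volume).toReal = Real.sqrt (y τ) := by
    simp only [hy_def]
    rw [← toReal_eLpNorm_two_sq_eq_integral hwm, Real.sqrt_sq ENNReal.toReal_nonneg]
  calc (eLpNorm (fun x => u τ x - heatExtension (u 0) τ x) 2 volume).toReal
      ≤ (eLpNorm (fun x => u τ x - E' τ x) 2 volume + eLpNorm (fun x => heatExtension (u 0) τ x - E' τ x) 2 volume).toReal := by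
        refine ENNReal.toReal_mono (ENNReal.add_ne_top.2 ⟨hfinw, hfinW⟩) ?_
        rw [hUeq]
        exact eLpNorm_sub_le hwm.1 hWm.1 one_le_two
    _ = Real.sqrt (y τ) + (eLpNorm (fun x => heatExtension (u 0) τ x - E' τ x) 2 volume).toReal := by
        rw [ENNReal.toReal_add hfinw hfinW, hsqrt]
    _ ≤ Real.sqrt (((c₁ * Bt) ^ 2 + Iβ) * Real.exp Iα) + c₁ * Bt := by
        have h1 : (eLpNorm (fun x => heatExtension (u 0) τ x - E' τ x) 2 volume).toReal ≤ c₁ * Bt := by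
          have h := ENNReal.toReal_mono ENNReal.ofReal_ne_top hWle
          rwa [ENNReal.toReal_ofReal (mul_nonneg hc₁0 hBt0)] at h
        exact add_le_add (Real.sqrt_le_sqrt hyτ) h1



/-! ### The initial layer -/

/-- **The initial layer of bounded mild solutions with weak-`L³` data** (Barker–Seregin–Šverák
2016, Lemma 3.4; Albritton–Barker 2019, proof of Thm. 4.1): there is `Λ : ℝ≥0 → ℝ≥0` such that
for every bounded, jointly continuous, weakly divergence-free solution `u` of the Oseen integral
equation on `[0, S] × ℝ³`, `S ≤ 1`, with `sup_s s³|{|u(0)| > s}| ≤ M`,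
`‖u(τ) − e^{τΔ}u(0)‖_{L²(ℝ³)} ≤ Λ(M) τ^{1/4}` for all `τ ∈ (0, S)`
(`eLpNorm_sub_heatExtension_le_of_splitting` with the splitting at height `N = τ^{-1/2}` and
`layer_bookkeeping`). [cite: BarkerSeregin2016, Lemma 3.4] -/
theorem weakL3_initial_layer :
    ∃ Λ : ℝ≥0 → ℝ, (∀ M, 0 ≤ Λ M) ∧ ∀ (M : ℝ≥0) (S : ℝ), 0 < S → S ≤ 1 →
      ∀ u : ℝ → EuclideanSpace ℝ (Fin 3) → EuclideanSpace ℝ (Fin 3),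
        ContinuousOn (uncurry u) (Icc 0 S ×ˢ univ) →
        (∃ C : ℝ, ∀ t ∈ Icc 0 S, ∀ x, ‖u t x‖ ≤ C) →
        (∀ t ∈ Icc 0 S, IsWeaklyDivFree (u t)) →
        (∀ s t : ℝ, 0 ≤ s → s < t → t ≤ S → ∀ x,
          u t x = heatExtension (u s) (t - s) x - oseenDuhamel 1 s u u t x) →
        eWeakLpPow (u 0) 3 volume ≤ M →
        ∀ τ ∈ Ioo 0 S, MemLp (fun x => u τ x - heatExtension (u 0) τ x) 2 volume ∧
          (eLpNorm (fun x => u τ x - heatExtension (u 0) τ x) 2 volume).toReal ≤ Λ M * τ ^ (1 / 4 : ℝ) := by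
  obtain ⟨C, hC0, hCF⟩ := caloricField_bounds
  set c₁ : ℝ := 2 * ‖(traceCLM : (EuclideanSpace ℝ (Fin 3) →L[ℝ] EuclideanSpace ℝ (Fin 3)) →L[ℝ] ℝ)‖ ^ 2 + 3 with hc₁
  have hc₁0 : 0 ≤ c₁ := by positivity
  refine ⟨fun M => Real.sqrt ((c₁ ^ 2 * (3 * (M : ℝ)) + 20 / 9 * C ^ 4 * ((10 : ℝ) ^ (6 / 5 : ℝ) * (M : ℝ) ^ (6 / 5 : ℝ))) *
      Real.exp (40 * C * ((10 : ℝ) ^ (3 / 10 : ℝ) * (M : ℝ) ^ (3 / 10 : ℝ)) + 4)) + c₁ * Real.sqrt (3 * (M : ℝ)),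
    fun M => by positivity, ?_⟩
  intro M S hS hS1 u hcont hbdd hdiv hmild hM τ hτ
  obtain ⟨K, hK⟩ := hbdd
  have hτ0 : 0 < τ := hτ.1
  -- the datum
  have hu0c : Continuous (u 0) :=
    (hcont.comp_continuous (f := fun x : EuclideanSpace ℝ (Fin 3) => ((0 : ℝ), x)) (by fun_prop)
      fun x => ⟨⟨le_rfl, hS.le⟩, mem_univ _⟩ :)
  have hK0 : ∀ x, ‖u 0 x‖ ≤ K := fun x => hK 0 ⟨le_rfl, hS.le⟩ x
  have h0 : MemWeakLp (u 0) 3 volume := ⟨hu0c.aestronglyMeasurable, hM.trans_lt ENNReal.coe_lt_top⟩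
  have hK' : ∀ x, ‖u 0 x‖ ≤ max K 1 := fun x => (hK0 x).trans (le_max_left _ _)
  have h4 : MemLp (u 0) 4 volume :=
    h0.memLp_of_norm_le (lt_of_lt_of_le one_pos (le_max_right _ _)) hK' (by norm_num) (by norm_num)
  -- the splitting at height `N = τ^{-1/2}`
  have hN : 0 < τ ^ (-(1 / 2 : ℝ)) := Real.rpow_pos_of_pos hτ0 _
  obtain ⟨gb, gt, hsum, -, -, hgbN, -, hgtK, hgb, hA, hgt, hBt⟩ :=
    weakL3_splitting hu0c.stronglyMeasurable hK0 hM hN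
  obtain ⟨hmem, hle⟩ := eLpNorm_sub_heatExtension_le_of_splitting hS hcont hK hdiv hmild h0 h4 hC0 hCF hsum
    hgbN hgtK hgb hgt hτ
  refine ⟨hmem, hle.trans ?_⟩
  -- bookkeeping
  set A : ℝ := (eLpNorm gb (10 / 3) volume).toReal with hA_def
  set Bt : ℝ := (eLpNorm gt 2 volume).toReal with hBt_def
  have hA0 : 0 ≤ A := ENNReal.toReal_nonneg
  have hBt0 : 0 ≤ Bt := ENNReal.toReal_nonneg
  obtain ⟨b1, b2, b3⟩ := layer_bookkeeping hτ0 (M := (M : ℝ)) M.coe_nonneg hA0 hBt0 hA hBt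
  set L₁ : ℝ := c₁ ^ 2 * (3 * (M : ℝ)) + 20 / 9 * C ^ 4 * ((10 : ℝ) ^ (6 / 5 : ℝ) * (M : ℝ) ^ (6 / 5 : ℝ)) with hL₁
  set eL : ℝ := Real.exp (40 * C * ((10 : ℝ) ^ (3 / 10 : ℝ) * (M : ℝ) ^ (3 / 10 : ℝ)) + 4) with heL
  have hL₁0 : 0 ≤ L₁ := by positivity
  have hτ14 : Real.sqrt (τ ^ (1 / 2 : ℝ)) = τ ^ (1 / 4 : ℝ) := by
    rw [Real.sqrt_eq_rpow, ← Real.rpow_mul hτ0.le]; norm_num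
  -- the first factor
  have h1 : (c₁ * Bt) ^ 2 + 20 / 9 * C ^ 4 * A ^ 4 * τ ^ (7 / 10 : ℝ) ≤ L₁ * τ ^ (1 / 2 : ℝ) := by
    have e1 : (c₁ * Bt) ^ 2 = c₁ ^ 2 * Bt ^ 2 := by ring
    have h11 : c₁ ^ 2 * Bt ^ 2 ≤ c₁ ^ 2 * (3 * (M : ℝ) * τ ^ (1 / 2 : ℝ)) := mul_le_mul_of_nonneg_left b3 (by positivity)
    have h12 : 20 / 9 * C ^ 4 * A ^ 4 * τ ^ (7 / 10 : ℝ) ≤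
        20 / 9 * C ^ 4 * ((10 : ℝ) ^ (6 / 5 : ℝ) * (M : ℝ) ^ (6 / 5 : ℝ) * τ ^ (1 / 2 : ℝ)) := by
      have := mul_le_mul_of_nonneg_left b2 (show 0 ≤ 20 / 9 * C ^ 4 by positivity)
      calc 20 / 9 * C ^ 4 * A ^ 4 * τ ^ (7 / 10 : ℝ) = 20 / 9 * C ^ 4 * (A ^ 4 * τ ^ (7 / 10 : ℝ)) := by ring
        _ ≤ 20 / 9 * C ^ 4 * ((10 : ℝ) ^ (6 / 5 : ℝ) * (M : ℝ) ^ (6 / 5 : ℝ) * τ ^ (1 / 2 : ℝ)) := this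
    rw [e1, hL₁]
    nlinarith
  -- the exponential factor
  have h2 : Real.exp (40 * C * A * τ ^ (1 / 20 : ℝ) + 4) ≤ eL := by
    rw [heL]
    refine Real.exp_le_exp.2 ?_
    have := mul_le_mul_of_nonneg_left b1 (show 0 ≤ 40 * C by positivity)
    nlinarith
  -- the caloric remainder
  have h3 : c₁ * Bt ≤ c₁ * Real.sqrt (3 * (M : ℝ)) * τ ^ (1 / 4 : ℝ) := by
    have : Bt ≤ Real.sqrt (3 * (M : ℝ) * τ ^ (1 / 2 : ℝ)) := by
      rw [← Real.sqrt_sq hBt0]; exact Real.sqrt_le_sqrt b3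
    rw [Real.sqrt_mul (by positivity), hτ14] at this
    calc c₁ * Bt ≤ c₁ * (Real.sqrt (3 * (M : ℝ)) * τ ^ (1 / 4 : ℝ)) := mul_le_mul_of_nonneg_left this hc₁0
      _ = c₁ * Real.sqrt (3 * (M : ℝ)) * τ ^ (1 / 4 : ℝ) := by ring
  have h4' : Real.sqrt (((c₁ * Bt) ^ 2 + 20 / 9 * C ^ 4 * A ^ 4 * τ ^ (7 / 10 : ℝ)) *
      Real.exp (40 * C * A * τ ^ (1 / 20 : ℝ) + 4)) ≤ Real.sqrt (L₁ * eL) * τ ^ (1 / 4 : ℝ) := by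
    have hle : ((c₁ * Bt) ^ 2 + 20 / 9 * C ^ 4 * A ^ 4 * τ ^ (7 / 10 : ℝ)) *
        Real.exp (40 * C * A * τ ^ (1 / 20 : ℝ) + 4) ≤ (L₁ * eL) * τ ^ (1 / 2 : ℝ) := by
      calc ((c₁ * Bt) ^ 2 + 20 / 9 * C ^ 4 * A ^ 4 * τ ^ (7 / 10 : ℝ)) * Real.exp (40 * C * A * τ ^ (1 / 20 : ℝ) + 4)
          ≤ (L₁ * τ ^ (1 / 2 : ℝ)) * eL := mul_le_mul h1 h2 (Real.exp_pos _).le (by positivity)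
        _ = (L₁ * eL) * τ ^ (1 / 2 : ℝ) := by ring
    calc Real.sqrt (((c₁ * Bt) ^ 2 + 20 / 9 * C ^ 4 * A ^ 4 * τ ^ (7 / 10 : ℝ)) *
          Real.exp (40 * C * A * τ ^ (1 / 20 : ℝ) + 4))
        ≤ Real.sqrt ((L₁ * eL) * τ ^ (1 / 2 : ℝ)) := Real.sqrt_le_sqrt hle
      _ = Real.sqrt (L₁ * eL) * τ ^ (1 / 4 : ℝ) := by rw [Real.sqrt_mul (by positivity), hτ14]
  calc Real.sqrt (((c₁ * Bt) ^ 2 + 20 / 9 * C ^ 4 * A ^ 4 * τ ^ (7 / 10 : ℝ)) *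
        Real.exp (40 * C * A * τ ^ (1 / 20 : ℝ) + 4)) + c₁ * Bt
      ≤ Real.sqrt (L₁ * eL) * τ ^ (1 / 4 : ℝ) + c₁ * Real.sqrt (3 * (M : ℝ)) * τ ^ (1 / 4 : ℝ) := add_le_add h4' h3
    _ = (Real.sqrt (L₁ * eL) + c₁ * Real.sqrt (3 * (M : ℝ))) * τ ^ (1 / 4 : ℝ) := by ring

end Literature.Analysis.FluidPDE

end
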